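import Literature.NumberTheory.ComplexMultiplication.CMTypeRankCommonConstituent
import Literature.NumberTheory.ComplexMultiplication.PartialConjugationOfRealIntersection
import Literature.NumberTheory.ComplexMultiplication.PartialConjugationOfConjSquare
import Summits.HodgeConjecture.CorCM.ImaginaryQuadraticsTimesConjSquareCMHodge
import Summits.HodgeConjecture.CorCM.SmallIntersectionCMFieldsHodge
import HarnessLib

/-!
# Products of CM elliptic curves and SEVERAL CM abelian varieties under PAIRWISE conditions: the "no common
# constituent" criterion at the level of CM fields, and the Hodge conjecture for `∏_j E_j^{a_j} × ∏_b S_b^{c_b}`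

COR-CM (cell `pub-hodgecm2`, seat p2 gen 17, count-neutral claim MASTER-CC (F5)); NEW as stated, hence under `Summits/`.
Theorems only; no definition, no named fact, no `sorry`.

`CMTypeRankCommonConstituent` (F4) proves: if for every ordered pair of slots `i ≠ j` the Galois modules `U(Φ_i)`,
`U(Φ_j)` have no common constituent (no non-zero stable `P ≤ U(Φ_i)` with an equivariant `T : ℚ^{E_i} → ℚ^{E_j}` injective
on `P` into `U(Φ_j)`), then `U(Σ) = ⊕_i U(Φ_i)` and the family is nondegenerate iff every member is.  This file
instantiates it for `G = Aut(ℂ)` on `⊔_i Hom(K_i, ℂ)` and supplies the pairwise condition from a MENU of field-level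
facts, one per kind of pair:

* two imaginary quadratic slots `i, j`: their sign characters differ (`χ_i ≠ χ_j`; from a separating quadratic
  sub-family, `TwoSlot.slotSign_injective_of_separating`, seat lit-deligne-3) — `PairwiseCC.eq_zero_of_eigen_of_card_eq_two`;
* an imaginary quadratic slot and a slot `b` with (□) `τ ∘ τ ∘ s = s̄` on `Hom(K_b, ℂ)` (every quartic CM field with a
  primitive type, F2's `QuarticCM.exists_ringAut_smul_smul_eq_conjugate_of_isPrimitive`): `U(Φ_b)` has no `χ`-eigenvector
  for ANY `χ` (`(χ(τ)² + 1) f = 0`) — `PairwiseCC.eq_zero_of_eigen_of_smul_smul`;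
* two non-quadratic slots `a, b`: a PAIRWISE partial conjugation (`σ` = conjugation on `Hom(K_a, ℂ)`, identity on
  `Hom(K_b, ℂ)`, nothing asked elsewhere; from b23's `forall_exists_partialConj_pair`: conjugation fixes `L_a ∩ L_b`) —
  F4's `pairwise_of_partialConj`.

Results: **`isNondegenerateFamily_iff_forall_of_pairwise`** (CM form of F4), **`pairwise_of_menu`** /
**`isNondegenerateFamily_iff_of_menu`** (`(Φ_i)_i` nondegenerate ⟺ every non-quadratic `Φ_b` nondegenerate),
`hodgeConjectureFor_prod_of_menu`, and the field-level instances
**`hodgeConjectureFor_prod_curves_surfaces_of_realIntersection`** — the Hodge conjecture for EVERY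
`E_1^{a_1} × ⋯ × E_r^{a_r} × S_1^{c_1} × ⋯ × S_m^{c_m}` with `E_j` pairwise non-isogenous CM elliptic curves (a separating
quadratic family) and `S_b` SIMPLE CM abelian surfaces such that complex conjugation fixes `L_a ∩ L_b` pointwise for
`a ≠ b` (PAIRWISE, no condition against the curves) — and **`hodgeConjectureFor_prod_curves_surfaces_of_cyclic_of_ne`**
(all fields Galois with cyclic group — automatic for the curves —, the surfaces' quartic fields with pairwise different
Galois closures: HYPOTHESIS-FREE beyond that), unconditionally.  These contain F2 (one surface), F3 (block condition),
b23's pair theorems (`SmallIntersectionCMFieldsHodge`) and lit-deligne-3's curve theorem as special cases.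

Sources: [Gordon1999HodgeAVSurvey] §3 (Imai–Murty), 7.5, 10.10; [MoonenZarhin1999LowDim] Cor. (3.9); [Shimura1998]
§8.2 Prop. 26, §8.4 (2); [Deligne1982HodgeCycles] I Ex. 3.7.
-/

noncomputable section

open CategoryTheory CategoryTheory.Limits NumberField NumberField.ComplexEmbedding IntermediateField
open scoped BigOperators

/-! ## §0 Abstract pairwise conditions: eigenvectors on two-element slots and under (□) -/

namespace Summit.HodgeConjecture.CorCM.PairwiseCC

open Literature.NumberTheory.ComplexMultiplication
open Summit.HodgeConjecture.CorCM.TwoSlot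

variable {G : Type*} [Group G] {I : Type*} {E : I → Type*} [∀ i, MulAction G (E i)] {ρ : G} {Φ : ∀ i, Set (E i)}

/-- On a two-element slot every element of `U(Φ_i) = ℚ u_1` is a `χ_i`-eigenvector: `f ∘ (g • ·) = χ_i(g) f`.
[cite: MoonenZarhin1999LowDim, Cor. (3.9) (proof)] -/
theorem comp_smul_eq_slotSign_smul [∀ i, Fintype (E i)] [∀ i, DecidableEq (E i)] {i : I}
    (h : IsCMTypeWith ρ (Φ i)) (hc : Fintype.card (E i) = 2) {f : E i → ℚ} (hf : f ∈ antiSpan G (Φ i)) (g : G) :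
    (fun x => f (g • x)) = slotSign G E i g • f := by
  induction hf using Submodule.span_induction with
  | mem u hu =>
    obtain ⟨k, rfl⟩ := hu
    show (fun x => antiVec (Φ i) k (g • x)) = slotSign G E i g • antiVec (Φ i) k
    rw [antiVec_comp_smul]
    funext s
    rw [Pi.smul_apply, smul_eq_mul, antiVec_eq_slotSign_mul h hc (k * g) s, antiVec_eq_slotSign_mul h hc k s, map_mul]
    ring
  | zero => funext s; simp
  | add u v _ _ hu hv =>
    rw [smul_add, ← hu, ← hv]
    rfl
  | smul c u _ hu =>
    rw [smul_comm, ← hu]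
    rfl

/-- **Under (□) `U(Ψ)` has no eigenvector for any rational character**: if `τ² = ρ` on `X` and `f ∈ U(Ψ)` satisfies
`f ∘ (g • ·) = χ(g) f` for all `g`, then `χ(τ)² f = f ∘ ρ = −f`, so `f = 0`. [cite: Gordon1999HodgeAVSurvey, §3 Theorem (proof)] -/
theorem eq_zero_of_eigen_of_smul_smul {X : Type*} [MulAction G X] {Ψ : Set X} (h : IsCMTypeWith ρ Ψ) {τ : G}
    (hτ : ∀ x : X, τ • τ • x = ρ • x) (χ : G → ℚ) {f : X → ℚ} (hf : f ∈ antiSpan G Ψ)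
    (heig : ∀ g : G, (fun x => f (g • x)) = χ g • f) : f = 0 := by
  have h1 : (fun x => f (τ • τ • x)) = (χ τ * χ τ) • f := by
    funext x
    have a := congrFun (heig τ) (τ • x)
    have b := congrFun (heig τ) x
    simp only [Pi.smul_apply, smul_eq_mul] at a b ⊢
    rw [a, b]
    ring
  have h2 : (fun x => f (τ • τ • x)) = -f := by
    funext x
    rw [hτ x, apply_rho_smul_of_mem_antiSpan h hf x, Pi.neg_apply]
  rw [h2] at h1
  have h3 : (χ τ * χ τ + 1) • f = 0 := by rw [add_smul, one_smul, ← h1, neg_add_cancel]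
  have hpos : χ τ * χ τ + 1 ≠ 0 := (add_pos_of_nonneg_of_pos (mul_self_nonneg (χ τ)) one_pos).ne'
  exact (smul_eq_zero.1 h3).resolve_left hpos

/-- **On a two-element slot a `χ`-eigenvector vanishes unless `χ = χ_i`** (`(χ(g) − χ_i(g)) f = 0`).
[cite: MoonenZarhin1999LowDim, Cor. (3.9) (proof)] -/
theorem eq_zero_of_eigen_of_card_eq_two [∀ i, Fintype (E i)] [∀ i, DecidableEq (E i)] {i : I}
    (h : IsCMTypeWith ρ (Φ i)) (hc : Fintype.card (E i) = 2) (χ : G → ℚ) (hne : ∃ g : G, χ g ≠ slotSign G E i g)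
    {f : E i → ℚ} (hf : f ∈ antiSpan G (Φ i)) (heig : ∀ g : G, (fun x => f (g • x)) = χ g • f) : f = 0 := by
  obtain ⟨g, hg⟩ := hne
  have h1 : (χ g - slotSign G E i g) • f = 0 := by
    rw [sub_smul, ← heig g, comp_smul_eq_slotSign_smul h hc hf g, sub_self]
  exact (smul_eq_zero.1 h1).resolve_left (sub_ne_zero.2 hg)

end Summit.HodgeConjecture.CorCM.PairwiseCC

/-! ## §1 CM fields -/

namespace Summit.HodgeConjecture.CorCM

open Literature.NumberTheory.ComplexMultiplication
open Literature.AlgebraicGeometry.Motives (AbelianVariety CMType)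
open Literature.AlgebraicGeometry.HodgeTheory
open Literature.AlgebraicGeometry.ComplexMultiplication (IsCMTypeRealisation isSimple_iff_isPrimitive)
open Literature.AlgebraicGeometry.VanGeemen1994 (hodgeClassSpan)
open Literature.AlgebraicGeometry.Pohlmann1968
open Literature.Barriers.HodgeConjecture (divisorClassesSpan)

section Fields

variable {I : Type} {K : I → Type} [∀ i, Field (K i)] [∀ i, NumberField (K i)] [∀ i, IsCMField (K i)] [Fintype I]
  [DecidableEq I]

omit [∀ i, IsCMField (K i)] [DecidableEq I] in
/-- `|⊔_i Hom(K_i, ℂ)| = Σ_i [K_i : ℚ]`. [folklore] -/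
private theorem card_sigma_ringHom_eq_sum'' :
    Fintype.card ((i : I) × (K i →+* ℂ)) = ∑ i, Module.finrank ℚ (K i) := by
  rw [Fintype.card_sigma]
  exact Finset.sum_congr rfl fun i _ => Embeddings.card (K i) ℂ

/-- **The pairwise criterion for CM fields**: if for all `i ≠ j` the Galois modules `U(Φ_i) ⊆ ℚ^{Hom(K_i, ℂ)}` and
`U(Φ_j)` have no common constituent, then `(Φ_i)_i` is nondegenerate iff every `Φ_i` is — `∏_i A_{Φ_i}` is stably
nondegenerate iff every factor is. [cite: Gordon1999HodgeAVSurvey, §3 Theorem and 7.5] -/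
theorem isNondegenerateFamily_iff_forall_of_pairwise [Nonempty I] (Φ : ∀ i, CMType (K i))
    (hpair : ∀ i j, i ≠ j → ∀ P : Submodule ℚ ((K i →+* ℂ) → ℚ), P ≤ antiSpan (ℂ ≃+* ℂ) (Φ i).1 →
      (∀ g : ℂ ≃+* ℂ, ∀ f ∈ P, (fun x => f (g • x)) ∈ P) →
      ∀ T : ((K i →+* ℂ) → ℚ) →ₗ[ℚ] ((K j →+* ℂ) → ℚ),
        (∀ g : ℂ ≃+* ℂ, ∀ f ∈ P, T (fun x => f (g • x)) = fun y => T f (g • y)) →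
        (∀ f ∈ P, T f ∈ antiSpan (ℂ ≃+* ℂ) (Φ j).1) → (∀ f ∈ P, T f = 0 → f = 0) → P = ⊥) :
    CMAlgebra.IsNondegenerateFamily Φ ↔ ∀ i, IsNondegenerate (Φ i) := by
  have key := typeRank_sigmaType_eq_iff_forall_of_pairwise (G := ℂ ≃+* ℂ) (Φ := fun i => (Φ i).1)
    (fun i => isCMTypeWith_conj (Φ i)) hpair
  rw [CMAlgebra.isNondegenerateFamily_iff, ← card_sigma_ringHom_eq_sum'' (K := K)]
  refine key.trans (forall_congr' fun i => ?_)
  rw [isNondegenerate_iff, cmTypeRank, ← Embeddings.card (K i) ℂ]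

/-- **Rank additivity for CM fields under the pairwise criterion**: `rank((Φ_i)_i) + |I| = Σ_i rank(Φ_i) + 1`
(`Hg(∏_i A_{Φ_i}) = ∏_i Hg(A_{Φ_i})`). [cite: Gordon1999HodgeAVSurvey, §3 Theorem (1)] -/
theorem cmFamilyRank_add_card_eq_of_pairwise [Nonempty I] (Φ : ∀ i, CMType (K i))
    (hpair : ∀ i j, i ≠ j → ∀ P : Submodule ℚ ((K i →+* ℂ) → ℚ), P ≤ antiSpan (ℂ ≃+* ℂ) (Φ i).1 →
      (∀ g : ℂ ≃+* ℂ, ∀ f ∈ P, (fun x => f (g • x)) ∈ P) →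
      ∀ T : ((K i →+* ℂ) → ℚ) →ₗ[ℚ] ((K j →+* ℂ) → ℚ),
        (∀ g : ℂ ≃+* ℂ, ∀ f ∈ P, T (fun x => f (g • x)) = fun y => T f (g • y)) →
        (∀ f ∈ P, T f ∈ antiSpan (ℂ ≃+* ℂ) (Φ j).1) → (∀ f ∈ P, T f = 0 → f = 0) → P = ⊥) :
    CMAlgebra.cmFamilyRank Φ + Fintype.card I = (∑ i, cmTypeRank (Φ i)) + 1 :=
  typeRank_sigmaType_add_card_eq_of_pairwise (G := ℂ ≃+* ℂ) (Φ := fun i => (Φ i).1)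
    (fun i => isCMTypeWith_conj (Φ i)) hpair

omit [Fintype I] [DecidableEq I] in
/-- **The menu.**  The pairwise criterion holds for a family whose slots off `B = {i | p i}` are imaginary quadratic
with pairwise different sign characters, whose slots in `B` satisfy (□), and whose pairs of slots in `B` carry pairwise
partial conjugations. [cite: Gordon1999HodgeAVSurvey, §3 Theorem (proof)] -/
theorem pairwise_of_menu (p : I → Prop) (Φ : ∀ i, CMType (K i))
    (h2 : ∀ j, ¬p j → Module.finrank ℚ (K j) = 2)
    (hχ : ∀ i j, ¬p i → ¬p j → i ≠ j → ∃ g : ℂ ≃+* ℂ,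
      ¬((∀ s : K i →+* ℂ, g • s = s) ↔ ∀ s : K j →+* ℂ, g • s = s))
    (hsq : ∀ b, p b → ∃ τ : ℂ ≃+* ℂ, ∀ s : K b →+* ℂ, τ • τ • s = conjugate s)
    (hbb : ∀ a b, p a → p b → a ≠ b →
      ∃ σ : ℂ ≃+* ℂ, (∀ s : K a →+* ℂ, σ • s = conjugate s) ∧ ∀ s : K b →+* ℂ, σ • s = s) :
    ∀ i j, i ≠ j → ∀ P : Submodule ℚ ((K i →+* ℂ) → ℚ), P ≤ antiSpan (ℂ ≃+* ℂ) (Φ i).1 →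
      (∀ g : ℂ ≃+* ℂ, ∀ f ∈ P, (fun x => f (g • x)) ∈ P) →
      ∀ T : ((K i →+* ℂ) → ℚ) →ₗ[ℚ] ((K j →+* ℂ) → ℚ),
        (∀ g : ℂ ≃+* ℂ, ∀ f ∈ P, T (fun x => f (g • x)) = fun y => T f (g • y)) →
        (∀ f ∈ P, T f ∈ antiSpan (ℂ ≃+* ℂ) (Φ j).1) → (∀ f ∈ P, T f = 0 → f = 0) → P = ⊥ := by
  classical
  have hCM : ∀ i, IsCMTypeWith (starRingAut : ℂ ≃+* ℂ) (Φ i).1 := fun i => isCMTypeWith_conj (Φ i)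
  have hc : ∀ j, ¬p j → Fintype.card (K j →+* ℂ) = 2 := fun j hj => by rw [Embeddings.card, h2 j hj]
  -- eigenvector facts on quadratic slots, and under (□)
  have hquad : ∀ j, ¬p j → ∀ f ∈ antiSpan (ℂ ≃+* ℂ) (Φ j).1, ∀ g : ℂ ≃+* ℂ,
      (fun x => f (g • x)) = TwoSlot.slotSign (ℂ ≃+* ℂ) (fun i => K i →+* ℂ) j g • f := fun j hj f hf g =>
    PairwiseCC.comp_smul_eq_slotSign_smul (Φ := fun i => (Φ i).1) (hCM j) (hc j hj) hf g
  have hsqz : ∀ b, p b → ∀ (χ : (ℂ ≃+* ℂ) → ℚ), ∀ f ∈ antiSpan (ℂ ≃+* ℂ) (Φ b).1,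
      (∀ g : ℂ ≃+* ℂ, (fun x => f (g • x)) = χ g • f) → f = 0 := fun b hb χ f hf heig => by
    obtain ⟨τ, hτ⟩ := hsq b hb
    exact PairwiseCC.eq_zero_of_eigen_of_smul_smul (hCM b) (τ := τ)
      (fun s => by rw [hτ s, conj_smul_eq_conjugate]) χ hf heig
  intro i j hij
  by_cases hi : p i <;> by_cases hj : p j
  · -- two slots of the block: a pairwise partial conjugation
    obtain ⟨σ, hσa, hσb⟩ := hbb i j hi hj hij
    exact (pairwise_of_partialConj (G := ℂ ≃+* ℂ) (Φ := fun i => (Φ i).1) hCM (i := i) (j := j) (σ := σ)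
      (fun s => by rw [hσa s, conj_smul_eq_conjugate]) hσb).1
  · -- `i` in the block, `j` quadratic: `U(Φ_i)` has no `χ_j`-eigenvector
    exact (pairwise_of_eigenvector (G := ℂ ≃+* ℂ) (Φ := fun i => (Φ i).1) (i := j) (j := i)
      (TwoSlot.slotSign (ℂ ≃+* ℂ) (fun i => K i →+* ℂ) j) (hquad j hj) (hsqz i hi _)).2
  · -- `i` quadratic, `j` in the block
    exact (pairwise_of_eigenvector (G := ℂ ≃+* ℂ) (Φ := fun i => (Φ i).1) (i := i) (j := j)
      (TwoSlot.slotSign (ℂ ≃+* ℂ) (fun i => K i →+* ℂ) i) (hquad i hi) (hsqz j hj _)).1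
  · -- two quadratic slots with different sign characters
    have hne : ∃ g : ℂ ≃+* ℂ,
        TwoSlot.slotSign (ℂ ≃+* ℂ) (fun i => K i →+* ℂ) i g ≠ TwoSlot.slotSign (ℂ ≃+* ℂ) (fun i => K i →+* ℂ) j g := by
      obtain ⟨g, hg⟩ := hχ i j hi hj hij
      refine ⟨g, fun heq => hg ?_⟩
      rw [TwoSlot.forall_smul_eq_iff_slotSign_eq_one (G := ℂ ≃+* ℂ) (E := fun i => K i →+* ℂ)
          (Φ := fun i => (Φ i).1) (hCM i) (hc i hi) g,
        TwoSlot.forall_smul_eq_iff_slotSign_eq_one (G := ℂ ≃+* ℂ) (E := fun i => K i →+* ℂ)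
          (Φ := fun i => (Φ i).1) (hCM j) (hc j hj) g, heq]
    exact (pairwise_of_eigenvector (G := ℂ ≃+* ℂ) (Φ := fun i => (Φ i).1) (i := i) (j := j)
      (TwoSlot.slotSign (ℂ ≃+* ℂ) (fun i => K i →+* ℂ) i) (hquad i hi) fun f hf heig =>
        PairwiseCC.eq_zero_of_eigen_of_card_eq_two (Φ := fun i => (Φ i).1) (hCM j) (hc j hj) _ hne hf heig).1

/-- **Nondegeneracy from the menu**: with imaginary quadratic slots of pairwise different sign characters off `B`, (□) on
`B`, and pairwise partial conjugations inside `B`, the family `(Φ_i)_i` is nondegenerate iff every `Φ_b`, `b ∈ B`, is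
nondegenerate (the quadratic types are automatically nondegenerate). [cite: Gordon1999HodgeAVSurvey, §3 Theorem and 7.5] -/
theorem isNondegenerateFamily_iff_of_menu [Nonempty I] (p : I → Prop) (Φ : ∀ i, CMType (K i))
    (h2 : ∀ j, ¬p j → Module.finrank ℚ (K j) = 2)
    (hχ : ∀ i j, ¬p i → ¬p j → i ≠ j → ∃ g : ℂ ≃+* ℂ,
      ¬((∀ s : K i →+* ℂ, g • s = s) ↔ ∀ s : K j →+* ℂ, g • s = s))
    (hsq : ∀ b, p b → ∃ τ : ℂ ≃+* ℂ, ∀ s : K b →+* ℂ, τ • τ • s = conjugate s)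
    (hbb : ∀ a b, p a → p b → a ≠ b →
      ∃ σ : ℂ ≃+* ℂ, (∀ s : K a →+* ℂ, σ • s = conjugate s) ∧ ∀ s : K b →+* ℂ, σ • s = s) :
    CMAlgebra.IsNondegenerateFamily Φ ↔ ∀ b, p b → IsNondegenerate (Φ b) := by
  rw [isNondegenerateFamily_iff_forall_of_pairwise Φ (pairwise_of_menu p Φ h2 hχ hsq hbb)]
  refine ⟨fun H b _ => H b, fun H i => ?_⟩
  by_cases hi : p i
  · exact H i hi
  · exact isNondegenerate_of_finrank_eq_two (Φ i) (h2 i hi)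

omit [Fintype I] [DecidableEq I] in
/-- **Different sign characters from a separating quadratic sub-family**: for distinct quadratic slots `i, j` some
automorphism of `ℂ` fixes the embeddings of one of `K_i, K_j` but not of the other (Kubota separation of the quadratic
part; pairwise non-isogenous CM elliptic curves). [cite: Kubota1965, §2 (p. 115)] -/
theorem exists_not_iff_of_isSeparatingFamily (p : I → Prop) (Φ : ∀ i, CMType (K i))
    (h2 : ∀ j, ¬p j → Module.finrank ℚ (K j) = 2)
    (hsep : CMAlgebra.IsSeparatingFamily (fun j : {j // ¬p j} => Φ j.1)) :
    ∀ i j, ¬p i → ¬p j → i ≠ j → ∃ g : ℂ ≃+* ℂ,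
      ¬((∀ s : K i →+* ℂ, g • s = s) ↔ ∀ s : K j →+* ℂ, g • s = s) := by
  classical
  intro i j hi hj hij
  have hCM : ∀ j : {j // ¬p j}, IsCMTypeWith (starRingAut : ℂ ≃+* ℂ) (Φ j.1).1 := fun j => isCMTypeWith_conj (Φ j.1)
  have hc : ∀ j : {j // ¬p j}, Fintype.card (K j.1 →+* ℂ) = 2 := fun j => by rw [Embeddings.card, h2 j.1 j.2]
  have hinj := TwoSlot.slotSign_injective_of_separating (G := ℂ ≃+* ℂ) (E := fun j : {j // ¬p j} => K j.1 →+* ℂ)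
    (Φ := fun j : {j // ¬p j} => (Φ j.1).1) hCM hc ((CMAlgebra.isSeparatingFamily_iff_smul _).1 hsep)
  by_contra hall
  have hall' : ∀ g : ℂ ≃+* ℂ, (∀ s : K i →+* ℂ, g • s = s) ↔ ∀ s : K j →+* ℂ, g • s = s :=
    fun g => not_not.1 fun hg => hall ⟨g, hg⟩
  have heq : TwoSlot.slotSign (ℂ ≃+* ℂ) (fun j : {j // ¬p j} => K j.1 →+* ℂ) ⟨i, hi⟩ =
      TwoSlot.slotSign (ℂ ≃+* ℂ) (fun j : {j // ¬p j} => K j.1 →+* ℂ) ⟨j, hj⟩ := by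
    refine MonoidHom.ext fun g => ?_
    rcases TwoSlot.forall_smul_eq_or_forall_smul_eq_rho_smul (G := ℂ ≃+* ℂ) (E := fun j : {j // ¬p j} => K j.1 →+* ℂ)
      (Φ := fun j : {j // ¬p j} => (Φ j.1).1) (i := ⟨i, hi⟩) (hCM ⟨i, hi⟩) (hc ⟨i, hi⟩) g with hgi | hgi
    · have hgj : ∀ s : K j →+* ℂ, g • s = s := (hall' g).1 hgi
      rw [TwoSlot.slotSign_of_forall_smul_eq (G := ℂ ≃+* ℂ) (E := fun j : {j // ¬p j} => K j.1 →+* ℂ) (i := ⟨i, hi⟩) hgi,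
        TwoSlot.slotSign_of_forall_smul_eq (G := ℂ ≃+* ℂ) (E := fun j : {j // ¬p j} => K j.1 →+* ℂ) (i := ⟨j, hj⟩) hgj]
    · rcases TwoSlot.forall_smul_eq_or_forall_smul_eq_rho_smul (G := ℂ ≃+* ℂ) (E := fun j : {j // ¬p j} => K j.1 →+* ℂ)
        (Φ := fun j : {j // ¬p j} => (Φ j.1).1) (i := ⟨j, hj⟩) (hCM ⟨j, hj⟩) (hc ⟨j, hj⟩) g with hgj | hgj
      · have hgi' : ∀ s : K i →+* ℂ, g • s = s := (hall' g).2 hgj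
        rw [TwoSlot.slotSign_of_forall_smul_eq (G := ℂ ≃+* ℂ) (E := fun j : {j // ¬p j} => K j.1 →+* ℂ) (i := ⟨i, hi⟩)
            hgi',
          TwoSlot.slotSign_of_forall_smul_eq (G := ℂ ≃+* ℂ) (E := fun j : {j // ¬p j} => K j.1 →+* ℂ) (i := ⟨j, hj⟩) hgj]
      · rw [TwoSlot.slotSign_of_forall_smul_eq_rho_smul (G := ℂ ≃+* ℂ) (E := fun j : {j // ¬p j} => K j.1 →+* ℂ)
            (Φ := fun j : {j // ¬p j} => (Φ j.1).1) (i := ⟨i, hi⟩) (hCM ⟨i, hi⟩) (hc ⟨i, hi⟩) hgi,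
          TwoSlot.slotSign_of_forall_smul_eq_rho_smul (G := ℂ ≃+* ℂ) (E := fun j : {j // ¬p j} => K j.1 →+* ℂ)
            (Φ := fun j : {j // ¬p j} => (Φ j.1).1) (i := ⟨j, hj⟩) (hCM ⟨j, hj⟩) (hc ⟨j, hj⟩) hgj]
  exact hij (congrArg Subtype.val (hinj heq))

end Fields

/-! ## §2 Geometry: curves and several surfaces under pairwise conditions -/

section Geometry

variable {I : Type} {K : I → Type} [∀ i, Field (K i)] [∀ i, NumberField (K i)] [∀ i, IsCMField (K i)] [Fintype I]
  [DecidableEq I] [Nonempty I] {Φ : ∀ i, CMType (K i)}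
variable {A : I → AbelianVariety ℂ} {ι : ∀ i, 𝓞 (K i) →+* End (A i)}
  {θ : ∀ i, K i →+* Module.End ℂ (complexBetti (A i).X 1)}

/-- **The Hodge conjecture from the menu**: every `⨁_{k<N} A_{π k}` for a family with imaginary quadratic slots forming a
separating sub-family off `B`, (□) and nondegenerate types on `B`, and pairwise partial conjugations inside `B` —
unconditionally. [cite: Gordon1999HodgeAVSurvey, §3 Theorem and 10.10] -/
theorem hodgeConjectureFor_prod_of_menu (p : I → Prop) (h2 : ∀ j, ¬p j → Module.finrank ℚ (K j) = 2)
    (hsep : CMAlgebra.IsSeparatingFamily (fun j : {j // ¬p j} => Φ j.1))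
    (hsq : ∀ b, p b → ∃ τ : ℂ ≃+* ℂ, ∀ s : K b →+* ℂ, τ • τ • s = conjugate s)
    (hbb : ∀ a b, p a → p b → a ≠ b →
      ∃ σ : ℂ ≃+* ℂ, (∀ s : K a →+* ℂ, σ • s = conjugate s) ∧ ∀ s : K b →+* ℂ, σ • s = s)
    (hΦ : ∀ b, p b → IsNondegenerate (Φ b)) (hA : ∀ i, IsCMTypeRealisation (Φ i) (A i) (ι i) (θ i)) {N : ℕ}
    (π : Fin N → I) : HodgeConjectureFor (⨁ fun j : Fin N => A (π j)).dim (⨁ fun j : Fin N => A (π j)).X :=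
  ((isNondegenerateFamily_iff_of_menu p Φ h2 (exists_not_iff_of_isSeparatingFamily p Φ h2 hsep) hsq hbb).2
    hΦ).hodgeConjectureFor_prod hA π

/-- **`Bᵐ ⊗ ℂ = Dᵐ ⊗ ℂ` from the menu** (no exotic Hodge class on any `⨁_{k<N} A_{π k}`).
[cite: Gordon1999HodgeAVSurvey, §3 Theorem (2) and 7.5] -/
theorem hodgeClassSpan_prod_eq_divisorClassesSpan_of_menu (p : I → Prop) (h2 : ∀ j, ¬p j → Module.finrank ℚ (K j) = 2)
    (hsep : CMAlgebra.IsSeparatingFamily (fun j : {j // ¬p j} => Φ j.1))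
    (hsq : ∀ b, p b → ∃ τ : ℂ ≃+* ℂ, ∀ s : K b →+* ℂ, τ • τ • s = conjugate s)
    (hbb : ∀ a b, p a → p b → a ≠ b →
      ∃ σ : ℂ ≃+* ℂ, (∀ s : K a →+* ℂ, σ • s = conjugate s) ∧ ∀ s : K b →+* ℂ, σ • s = s)
    (hΦ : ∀ b, p b → IsNondegenerate (Φ b)) (hA : ∀ i, IsCMTypeRealisation (Φ i) (A i) (ι i) (θ i)) {N : ℕ}
    (π : Fin N → I) (m : ℕ) :
    hodgeClassSpan (⨁ fun j : Fin N => A (π j)).dim (⨁ fun j : Fin N => A (π j)).X m =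
      divisorClassesSpan (⨁ fun j : Fin N => A (π j)).X (⨁ fun j : Fin N => A (π j)).dim m :=
  ((isNondegenerateFamily_iff_of_menu p Φ h2 (exists_not_iff_of_isSeparatingFamily p Φ h2 hsep) hsq hbb).2
    hΦ).hodgeClassSpan_prod_eq_divisorClassesSpan hA π m

omit [∀ i, IsCMField (K i)] [DecidableEq I] [Nonempty I] in
/-- Pairwise partial conjugation for two slots from the real-intersection condition (b23's two-slot criterion applied to
the sub-family `{a, b}`). [cite: Lang2002, VI §1 Thm. 1.12] -/
theorem exists_pairConj_of_conj_apply_eq {a b : I} (hab : a ≠ b)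
    (hreal : ∀ x : ℂ, x ∈ normalClosure ℚ (K a) ℂ → x ∈ normalClosure ℚ (K b) ℂ → starRingEnd ℂ x = x) :
    ∃ σ : ℂ ≃+* ℂ, (∀ s : K a →+* ℂ, σ • s = conjugate s) ∧ ∀ s : K b →+* ℂ, σ • s = s := by
  have h01 : (⟨a, Or.inl rfl⟩ : {x // x = a ∨ x = b}) ≠ ⟨b, Or.inr rfl⟩ := fun h => hab (congrArg Subtype.val h)
  have hI : ∀ j : {x // x = a ∨ x = b}, j = ⟨a, Or.inl rfl⟩ ∨ j = ⟨b, Or.inr rfl⟩ := fun j => by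
    rcases j.2 with h | h
    · exact Or.inl (Subtype.ext h)
    · exact Or.inr (Subtype.ext h)
  obtain ⟨σ, hσ, hσ'⟩ := forall_exists_partialConj_pair (K := fun x : {x // x = a ∨ x = b} => K x.1) h01 hI hreal
    ⟨a, Or.inl rfl⟩
  exact ⟨σ, fun s => by rw [hσ s, conj_smul_eq_conjugate], hσ' ⟨b, Or.inr rfl⟩ h01.symm⟩

/-- **The Hodge conjecture for every `E_1^{a_1} × ⋯ × E_r^{a_r} × S_1^{c_1} × ⋯ × S_m^{c_m}`** with `E_j` pairwise
non-isogenous CM elliptic curves (a separating family of imaginary quadratic types off `B`) and `S_b` (`b ∈ B`) SIMPLE CM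
abelian surfaces whose quartic CM fields satisfy, PAIRWISE for `a ≠ b` in `B`, that complex conjugation fixes
`L_a ∩ L_b` pointwise — every `⨁_{k<N} A_{π k}`, UNCONDITIONAL, no named fact; no condition between curves and surfaces.
[cite: Gordon1999HodgeAVSurvey, §3 Theorem and 10.10] [cite: Shimura1998, §8.2 Prop. 26 and §8.4 (2)] -/
theorem hodgeConjectureFor_prod_curves_surfaces_of_realIntersection (p : I → Prop)
    (h2 : ∀ j, ¬p j → Module.finrank ℚ (K j) = 2) (h4 : ∀ b, p b → Module.finrank ℚ (K b) = 4)
    (hsep : CMAlgebra.IsSeparatingFamily (fun j : {j // ¬p j} => Φ j.1))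
    (hreal : ∀ a b, p a → p b → a ≠ b → ∀ x : ℂ, x ∈ normalClosure ℚ (K a) ℂ →
      x ∈ normalClosure ℚ (K b) ℂ → starRingEnd ℂ x = x)
    (hA : ∀ i, IsCMTypeRealisation (Φ i) (A i) (ι i) (θ i)) (hS : ∀ b, p b → (A b).IsSimple) {N : ℕ}
    (π : Fin N → I) : HodgeConjectureFor (⨁ fun j : Fin N => A (π j)).dim (⨁ fun j : Fin N => A (π j)).X := by
  have hprim : ∀ b, p b → IsPrimitive (ℂ ≃+* ℂ) (Φ b).1 (Classical.arbitrary (K b →+* ℂ)) := fun b hb =>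
    (isSimple_iff_isPrimitive (hA b) _).1 (hS b hb)
  refine hodgeConjectureFor_prod_of_menu p h2 hsep (fun b hb => ?_) (fun a b ha hb hab => ?_) (fun b hb => ?_) hA π
  · exact QuarticCM.exists_ringAut_smul_smul_eq_conjugate_of_isPrimitive (h4 b hb) (hprim b hb)
  · exact exists_pairConj_of_conj_apply_eq hab (hreal a b ha hb hab)
  · exact QuarticCM.isNondegenerate_of_isPrimitive (h4 b hb) _ (hprim b hb)

/-- **Cyclic instance, hypothesis-free beyond "different Galois closures".**  All fields Galois with cyclic group
(automatic for imaginary quadratic fields; cyclic quartic for the surfaces); the Hodge conjecture holds on every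
`E_1^{a_1} × ⋯ × E_r^{a_r} × S_1^{c_1} × ⋯ × S_m^{c_m}` — every `⨁_{k<N} A_{π k}` — for pairwise non-isogenous CM elliptic
curves `E_j` and simple CM abelian surfaces `S_b` whose cyclic quartic CM fields have pairwise different Galois closures
(ALL types of the surfaces), unconditionally. [cite: Gordon1999HodgeAVSurvey, §3 Theorem and 10.10]
[cite: Shimura1998, §8.4 Example (2)(B)] -/
theorem hodgeConjectureFor_prod_curves_surfaces_of_cyclic_of_ne [∀ i, IsGalois ℚ (K i)]
    [∀ i, IsCyclic (K i ≃ₐ[ℚ] K i)] (p : I → Prop)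
    (h2 : ∀ j, ¬p j → Module.finrank ℚ (K j) = 2) (h4 : ∀ b, p b → Module.finrank ℚ (K b) = 4)
    (hsep : CMAlgebra.IsSeparatingFamily (fun j : {j // ¬p j} => Φ j.1))
    (hne : ∀ a b, p a → p b → a ≠ b → normalClosure ℚ (K a) ℂ ≠ normalClosure ℚ (K b) ℂ)
    (hA : ∀ i, IsCMTypeRealisation (Φ i) (A i) (ι i) (θ i)) {N : ℕ}
    (π : Fin N → I) : HodgeConjectureFor (⨁ fun j : Fin N => A (π j)).dim (⨁ fun j : Fin N => A (π j)).X := by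
  refine hodgeConjectureFor_prod_of_menu p h2 hsep (fun b hb => ?_) (fun a b ha hb hab => ?_) (fun b hb => ?_) hA π
  · exact ConjSquare.exists_ringAut_smul_smul_eq_conjugate_of_isCyclic (K := K b) (dvd_of_eq (h4 b hb).symm)
  · have h01 : (⟨a, Or.inl rfl⟩ : {x // x = a ∨ x = b}) ≠ ⟨b, Or.inr rfl⟩ := fun h => hab (congrArg Subtype.val h)
    have hI : ∀ j : {x // x = a ∨ x = b}, j = ⟨a, Or.inl rfl⟩ ∨ j = ⟨b, Or.inr rfl⟩ := fun j => by
      rcases j.2 with h | h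
      · exact Or.inl (Subtype.ext h)
      · exact Or.inr (Subtype.ext h)
    obtain ⟨σ, hσ, hσ'⟩ := forall_exists_partialConj_pair_of_cyclic_quartic_of_ne
      (K := fun x : {x // x = a ∨ x = b} => K x.1) h01 hI (h4 a ha) (h4 b hb) (hne a b ha hb hab) ⟨a, Or.inl rfl⟩
    exact ⟨σ, fun s => by rw [hσ s, conj_smul_eq_conjugate], hσ' ⟨b, Or.inr rfl⟩ h01.symm⟩
  · exact isNondegenerate_of_isCyclic_of_finrank_eq_four (h4 b hb) (Φ b)

end Geometry

end Summit.HodgeConjecture.CorCM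

end
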